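import Mathlib
import HarnessLib
import Summits.NavierStokesRegularity.NavierStokesRegularity.Theorems.QuarterLogPincerThinCascadeDefs
import Summits.NavierStokesRegularity.NavierStokesRegularity.Theorems.QuarterLogPincerTypeIQuantSubcubicExpViolatorCascade
import Summits.NavierStokesRegularity.NavierStokesRegularity.Theorems.QuarterLogPincerTypeIQuantSubcubicExpZoomPairingLimit
import Summits.NavierStokesRegularity.NavierStokesRegularity.Theorems.QuarterLogPincerTypeIQuantSubcubicExpZoomTraceBudget
import Summits.NavierStokesRegularity.NavierStokesRegularity.Theorems.DssFarFieldSlavingBlowupTypeIDssProfileSimilarityEnstrophyTimeOnlyThreshold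

/-!
# Crux `QuarterLogPincer.TypeIQuantSubcubicExp` (stmt-NavierStokesRegularity-24077), line `thin_cascade`:
  LIOUVILLE ⇒ QUANTITATIVE TRANSFER at a fixed Type-I constant, and the proved small-constant case

Lead-prover file (ns-tc-p1 g4, `--supports stmt-NavierStokesRegularity-24077`; ROUTE-INDEPENDENT: no
`Theses` import — the by-name consequences for the route decl live in the companion file
`QuarterLogPincerTypeIQuantSubcubicExpLiouvilleEdges.lean`).  With the registered stubs S1
`stub_cheapCascades` (p608901), I1 `stub_uniformScaledEnergy` (p619610) and S2 `stub_thinObjectExtraction`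
(p624656) landed, the line `thin_cascade` stands or falls with its deciding stub S3
`stub_thinCascadeLiouville` (no thin singular Type-I ancient object; the DSS wall — NOT attacked here).
This file does the lead's INTEGRATION, keeping the Type-I constant `M` fixed throughout (the landed S1/S2
quantify it away: `∃ M q`, `∃ M' q'`), with the crux's conclusion AT `M` written out verbatim:

* `quantSubcubicExpAt_of_forbiddenLengths` — S1 at a fixed `M`: if every budget `q > 0` has a length
  `K` admitting no cheap cascade `CheapCascade M q K`, then the crux's conclusion holds AT `M` (the
  optimal rate `F_*(A) = sSup` of the admissible values; verbatim the landed argument of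
  `ThinCascade.stub_cheapCascades`, fed by `cheapCascade_of_violator`).
* `exists_thinObject_of_cheapCascades` — S2 at fixed `(M, q)`: cheap cascades of every length with
  constants `(M, q)` yield a thin object with THE SAME constants, `ThinObject M q v g` (verbatim the
  landed assembly of `ThinCascade.stub_thinObjectExtraction`, which proves exactly this before
  discarding `M' = M`, `q' = q`).
* `not_thinObject_of_rateLiouville`, `not_thinObject_of_lt_one` — a thin object with constant `M` is a
  NONZERO member of the Type-I ancient mild class `IsTypeIAncientMild M` (it is singular at the origin),
  so ANY Liouville theorem for that class at level `M` excludes it; in particular none exists for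
  `M < 1` (`SimilarityEnstrophy.typeI_ancient_eq_zero_of_rate_lt_one`; the line's rung, re-homed from
  the skeleton).
* `quantSubcubicExpAt_of_noThinObject`, `quantSubcubicExpAt_of_rateLiouville` — **TRANSFER**: the
  thin-cascade Liouville statement at level `M`, resp. the rate-class Type-I Liouville theorem at level
  `M` (`∀ v, IsTypeIAncientMild M v → v ≡ 0` on `t < 0`), implies the QUANTITATIVE subcubic-exponential
  bound of the crux at level `M` (qualitative ⇒ quantitative, by the compactness chain S1 → I1 → S2; the
  rate function is a supremum, not explicit).
* `quantSubcubicExpAt_of_lt_one` — **PROVED RUNG (unconditional): the crux's statement holds at every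
  Type-I constant `M < 1`.**

HONEST FRAMING: the unconditional content is the small-constant case `M < 1` and the reductions; the
crux `TypeIQuantSubcubicExp` (all `M`; open content `M ≥ 1`), its parent `SuperlogCubeRate` and
Navier–Stokes regularity remain OPEN; S3 is untouched; no summit statement is proved by this file.
-/

noncomputable section

-- the summit-side namespace `Summit.NavierStokesRegularity.NavierStokesRegularity.…` (single-conjunct summit,
-- D-0017) repeats a component by design; the dupNamespace linter would flag every declaration.
set_option linter.dupNamespace false

namespace Summit.NavierStokesRegularity.NavierStokesRegularity.Theorems.ThinCascade

open MeasureTheory Set Function Metric Filter Topology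
open scoped ENNReal NNReal InnerProductSpace RealInnerProductSpace
open Literature.Analysis Literature.Analysis.FluidPDE
open Summit.NavierStokesRegularity.NavierStokesRegularity.Cruxes.TypeIQuantSubcubicExp.ThinCascade

/-! ### S1 at a fixed Type-I constant -/

/-- **S1 at a fixed Type-I constant `M`.**  If every budget `q > 0` has a length `K` for which no cheap
cascade `CheapCascade M q K` exists, then the conclusion of the crux holds AT `M`: there is a rate
function `F` with `F(A) ≤ exp(εA³)` for `A ≥ A₀(ε)` bounding `‖u(t,x)‖ √t` for all admissible data with
Type-I constant `M`.  Proof: verbatim the landed argument of `ThinCascade.stub_cheapCascades` — the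
optimal rate `F_*(A) := sSup` of the admissible values is finite (`q = 1`,
`cheapCascade_of_violator`, contrapositive), obeys the bound clause by `le_csSup`, and is `≤ exp(εA³)`
for `A ≥ max 2 ((4K(2/ε)+4)/ε)` (`q = 2/ε`, `Real.sSup_le`). [folklore] -/
theorem quantSubcubicExpAt_of_forbiddenLengths (M : ℝ)
    (hK : ∀ q : ℝ, 0 < q → ∃ K : ℕ, ¬ CheapCascade M q K) :
    ∃ F : ℝ → ℝ, (∀ ε : ℝ, 0 < ε → ∃ A₀ : ℝ, ∀ A : ℝ, A₀ ≤ A → F A ≤ Real.exp (ε * A ^ 3)) ∧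
      ∀ (T τ A : ℝ) (u : ℝ → EuclideanSpace ℝ (Fin 3) → EuclideanSpace ℝ (Fin 3))
        (p : ℝ → EuclideanSpace ℝ (Fin 3) → ℝ),
        (IsClassicalNSSolutionOn (Icc 0 T) 1 0 u p ∧ ∀ n : ℕ, ∃ C : NNReal, ∀ t ∈ Icc 0 T,
            eLpNorm (iteratedFDeriv ℝ n (u t)) 2 volume ≤ C) → 0 < τ →
        (∀ t ∈ Icc 0 T, ∀ x : EuclideanSpace ℝ (Fin 3), ‖u t x‖ ≤ M * (T + τ - t) ^ (-(1 / 2 : ℝ))) →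
        (∀ t ∈ Icc 0 T, eLpNorm (u t) 3 volume ≤ ENNReal.ofReal A) → 2 ≤ A →
        ∀ t ∈ Ioc 0 T, ∀ x : EuclideanSpace ℝ (Fin 3), ‖u t x‖ ≤ F A * t ^ (-(1 / 2 : ℝ)) := by
  -- the admissible values at `L³` level `A`
  obtain ⟨S, hS⟩ : ∃ S : ℝ → Set ℝ, S = fun A => {r : ℝ | ∃ (T τ : ℝ)
      (u : ℝ → EuclideanSpace ℝ (Fin 3) → EuclideanSpace ℝ (Fin 3))
      (p : ℝ → EuclideanSpace ℝ (Fin 3) → ℝ) (t : ℝ) (x : EuclideanSpace ℝ (Fin 3)),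
      TaoFrame T u p ∧ 0 < τ ∧
      (∀ t ∈ Icc 0 T, ∀ x : EuclideanSpace ℝ (Fin 3), ‖u t x‖ ≤ M * (T + τ - t) ^ (-(1 / 2 : ℝ))) ∧
      (∀ t ∈ Icc 0 T, eLpNorm (u t) 3 volume ≤ ENNReal.ofReal A) ∧ 2 ≤ A ∧
      t ∈ Ioc 0 T ∧ r = ‖u t x‖ * Real.sqrt t} := ⟨_, rfl⟩
  -- every admissible value is below `exp(2K(q) + A³/q + 2)`
  have hlt : ∀ q : ℝ, 0 < q → ∃ K : ℕ, ∀ A : ℝ, ∀ r ∈ S A,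
      r < Real.exp (2 * K + A ^ 3 / q + 2) := by
    intro q hq
    obtain ⟨K, hKq⟩ := hK q hq
    refine ⟨K, fun A r hr => ?_⟩
    rw [hS] at hr
    obtain ⟨T, τ, u, p, t, x, hframe, hτ, htypeI, hL3, hA, ht, rfl⟩ := hr
    by_contra hle
    exact hKq (cheapCascade_of_violator hframe hτ htypeI hL3 (by linarith) hq ht (not_lt.1 hle))
  -- finiteness (`q = 1`)
  have hbdd : ∀ A : ℝ, BddAbove (S A) := by
    obtain ⟨K, hK1⟩ := hlt 1 one_pos
    exact fun A => ⟨Real.exp (2 * K + A ^ 3 / 1 + 2), fun r hr => (hK1 A r hr).le⟩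
  refine ⟨fun A => sSup (S A), ?_, ?_⟩
  · -- growth `o(A³)`: budget `q = 2/ε`
    intro ε hε
    obtain ⟨K, hKε⟩ := hlt (2 / ε) (by positivity)
    refine ⟨max 2 ((4 * K + 4) / ε), fun A hA => ?_⟩
    have hA2 : 2 ≤ A := le_trans (le_max_left _ _) hA
    have hAK : (4 * K + 4) / ε ≤ A := le_trans (le_max_right _ _) hA
    have hAK' : 4 * (K : ℝ) + 4 ≤ ε * A := by
      rw [div_le_iff₀ hε] at hAK
      linarith [mul_comm A ε]
    have hA3 : A ≤ A ^ 3 := by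
      have h1 : (1 : ℝ) ≤ A ^ 2 := by nlinarith
      calc A = A * 1 := by ring
        _ ≤ A * A ^ 2 := mul_le_mul_of_nonneg_left h1 (by linarith)
        _ = A ^ 3 := by ring
    have hεA : ε * A ≤ ε * A ^ 3 := mul_le_mul_of_nonneg_left hA3 hε.le
    refine Real.sSup_le (fun r hr => (hKε A r hr).le.trans (Real.exp_le_exp.2 ?_)) (Real.exp_pos _).le
    have e : A ^ 3 / (2 / ε) = ε * A ^ 3 / 2 := by field_simp
    rw [e]
    linarith
  · -- the bound clause, by `le_csSup`
    intro T τ A u p hframe hτ htypeI hL3 hA t ht x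
    have hmem : ‖u t x‖ * Real.sqrt t ∈ S A := by
      rw [hS]
      exact ⟨T, τ, u, p, t, x, hframe, hτ, htypeI, hL3, hA, ht, rfl⟩
    exact le_mul_rpow_neg_half_of_mul_sqrt_le ht.1 (le_csSup (hbdd A) hmem)

/-! ### S2 at fixed constants -/

/-- **S2 at fixed constants `(M, q)`.**  Cheap cascades `CheapCascade M q K` of every length `K`, with
budget `q > 0`, yield a thin singular Type-I ancient object WITH THE SAME CONSTANTS, `ThinObject M q v g`
(KNSS zoom limit `W` of the cascades' final windows and the weak trace `g` of the zooms' final slices).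
Verbatim the landed assembly of `ThinCascade.stub_thinObjectExtraction` (clauses (1)–(6):
`exists_typeIAncientMild_zoomLimit_of_cheapCascades`, `uniformLocalEnergy_zoomLimit_of_cheapCascades`,
`singularAt_zoomLimit_of_cheapCascades`, `exists_traceLimit_of_cheapCascades`,
`tendsto_pairing_zoomLimit_of_cheapCascades`, `annulus_budget_of_weak`), which establishes exactly this
before weakening to `∃ M' q'`. [folklore] -/
theorem exists_thinObject_of_cheapCascades {M q : ℝ} (hq : 0 < q) (hK : ∀ K : ℕ, CheapCascade M q K) :
    ∃ (v : ℝ → EuclideanSpace ℝ (Fin 3) → EuclideanSpace ℝ (Fin 3))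
      (g : EuclideanSpace ℝ (Fin 3) → EuclideanSpace ℝ (Fin 3)), ThinObject M q v g := by
  -- (1) the zoom limit
  obtain ⟨T, τ, ρ, x₀, u, p, φ, W, hdata, hφ, hTI, -, hpt, -⟩ :=
    exists_typeIAncientMild_zoomLimit_of_cheapCascades hK
  -- (4) the trace along a further subsequence
  obtain ⟨ψ, g, hψ, hgli, hg2, hgw⟩ := exists_traceLimit_of_cheapCascades hdata hφ
  have hφψ : StrictMono (φ ∘ ψ) := hφ.comp hψ
  have hpt' : ∀ t < 0, ∀ x, Tendsto
      (fun j => ((ρ ((φ ∘ ψ) j)) • stPull (ρ ((φ ∘ ψ) j) ^ 2) (ρ ((φ ∘ ψ) j)) (T ((φ ∘ ψ) j))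
        (x₀ ((φ ∘ ψ) j)) (u ((φ ∘ ψ) j))) t x) atTop (𝓝 (W t x)) :=
    fun t ht x => (hpt t ht x).comp hψ.tendsto_atTop
  have hgw' : ∀ (ζ : EuclideanSpace ℝ (Fin 3) → EuclideanSpace ℝ (Fin 3)), MemLp ζ 2 volume →
      ∀ (a : ℝ), (∀ y, y ∉ ball (0 : EuclideanSpace ℝ (Fin 3)) a → ζ y = 0) →
      Tendsto (fun k => ∫ y, ⟪((ρ ((φ ∘ ψ) k)) • stPull (ρ ((φ ∘ ψ) k) ^ 2) (ρ ((φ ∘ ψ) k))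
        (T ((φ ∘ ψ) k)) (x₀ ((φ ∘ ψ) k)) (u ((φ ∘ ψ) k))) 0 y, ζ y⟫) atTop (𝓝 (∫ y, ⟪g y, ζ y⟫)) :=
    hgw
  refine ⟨W, g, hTI, uniformLocalEnergy_zoomLimit_of_cheapCascades hdata hφ hpt,
    singularAt_zoomLimit_of_cheapCascades hdata hφ hpt, hgli,
    tendsto_pairing_zoomLimit_of_cheapCascades hdata hφψ hpt' hgw', ?_⟩
  -- (6) the annular budget of the trace
  have hVc : ∀ k, Continuous (((ρ ((φ ∘ ψ) k)) • stPull (ρ ((φ ∘ ψ) k) ^ 2) (ρ ((φ ∘ ψ) k))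
      (T ((φ ∘ ψ) k)) (x₀ ((φ ∘ ψ) k)) (u ((φ ∘ ψ) k))) 0) := by
    intro k
    have hcl := (hdata ((φ ∘ ψ) k)).1.1
    have hT : T ((φ ∘ ψ) k) ∈ Icc 0 (T ((φ ∘ ψ) k)) :=
      ⟨le_trans (by positivity) (hdata ((φ ∘ ψ) k)).2.2.2.1, le_rfl⟩
    have huc : Continuous (u ((φ ∘ ψ) k) (T ((φ ∘ ψ) k))) := (hcl.contDiff_velocity hT).continuous
    have e : ((ρ ((φ ∘ ψ) k)) • stPull (ρ ((φ ∘ ψ) k) ^ 2) (ρ ((φ ∘ ψ) k)) (T ((φ ∘ ψ) k))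
        (x₀ ((φ ∘ ψ) k)) (u ((φ ∘ ψ) k))) 0 = fun y => (ρ ((φ ∘ ψ) k)) •
          u ((φ ∘ ψ) k) (T ((φ ∘ ψ) k) + ρ ((φ ∘ ψ) k) ^ 2 * 0)
            (x₀ ((φ ∘ ψ) k) + (ρ ((φ ∘ ψ) k)) • y) := by
      funext y; simp only [smul_stPull_apply]
    rw [e, mul_zero, add_zero]
    have hlin : Continuous fun y : EuclideanSpace ℝ (Fin 3) => x₀ ((φ ∘ ψ) k) + (ρ ((φ ∘ ψ) k)) • y :=
      continuous_const.add (continuous_id.const_smul (ρ ((φ ∘ ψ) k)))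
    exact (huc.comp hlin).const_smul (ρ ((φ ∘ ψ) k))
  have hbudget : ∀ j : ℕ, 1 ≤ j → ∀ᶠ k in atTop,
      ∫⁻ y in {y : EuclideanSpace ℝ (Fin 3) | 1 < ‖y‖ ∧ ‖y‖ < Real.exp j},
        ENNReal.ofReal (‖((ρ ((φ ∘ ψ) k)) • stPull (ρ ((φ ∘ ψ) k) ^ 2) (ρ ((φ ∘ ψ) k))
          (T ((φ ∘ ψ) k)) (x₀ ((φ ∘ ψ) k)) (u ((φ ∘ ψ) k))) 0 y‖ ^ 3) ≤ ENNReal.ofReal (q * j) := by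
    intro j hj
    filter_upwards [eventually_ge_atTop j] with k hk
    exact zoom_annulus_budget (hdata ((φ ∘ ψ) k)).2.2.1 (hdata ((φ ∘ ψ) k)).2.2.2.2.2.2.2 j hj
      (hk.trans (hφψ.id_le k))
  exact annulus_budget_of_weak hVc hgli.aestronglyMeasurable hg2 hgw' hq.le hbudget

/-! ### Thin objects against Liouville theorems at the same constant -/

/-- **A thin object is a nonzero member of the rate class at its own constant**, hence excluded by
any Liouville theorem for `IsTypeIAncientMild M` at level `M`: singularity at the origin produces a
point `(t, y)`, `t < 0`, with `‖v t y‖ > 0`. [folklore] -/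
theorem not_thinObject_of_rateLiouville {M : ℝ}
    (hL : ∀ v : ℝ → EuclideanSpace ℝ (Fin 3) → EuclideanSpace ℝ (Fin 3),
      IsTypeIAncientMild M v → ∀ t < 0, ∀ x, v t x = 0)
    (q : ℝ) (v : ℝ → EuclideanSpace ℝ (Fin 3) → EuclideanSpace ℝ (Fin 3))
    (g : EuclideanSpace ℝ (Fin 3) → EuclideanSpace ℝ (Fin 3)) : ¬ ThinObject M q v g := by
  rintro ⟨hv, -, hsing, -⟩
  obtain ⟨t, ht, y, -, hy⟩ := hsing 1 one_pos 0
  have hzero : v t y = 0 := hL v hv t ht.2 y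
  simp [hzero] at hy

/-- **No thin object with Type-I constant `M < 1`** (the line's proved rung, re-homed from the
skeleton `Lines/thin_cascade.lean`, `thinCascadeLiouville_of_lt_one`): the tree's time-only
small-constant Liouville theorem `SimilarityEnstrophy.typeI_ancient_eq_zero_of_rate_lt_one`
(`IsTypeIAncientMild M v`, `M < 1` ⇒ `v ≡ 0` on `t < 0`) kills every thin object at level `M`.
[folklore] -/
theorem not_thinObject_of_lt_one {M : ℝ} (hM : M < 1) (q : ℝ)
    (v : ℝ → EuclideanSpace ℝ (Fin 3) → EuclideanSpace ℝ (Fin 3))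
    (g : EuclideanSpace ℝ (Fin 3) → EuclideanSpace ℝ (Fin 3)) : ¬ ThinObject M q v g :=
  not_thinObject_of_rateLiouville
    (fun _ hw => SimilarityEnstrophy.typeI_ancient_eq_zero_of_rate_lt_one hw hM) q v g

/-! ### Transfer: Liouville at level `M` ⇒ the quantitative bound at level `M` -/

/-- **TRANSFER, thin-object form.**  If no thin object with Type-I constant `M` exists (any budget
`q > 0`), then the crux's quantitative subcubic-exponential bound holds at level `M`.  Proof: by
`exists_thinObject_of_cheapCascades` every budget has a forbidden length, and
`quantSubcubicExpAt_of_forbiddenLengths` concludes. [folklore] -/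
theorem quantSubcubicExpAt_of_noThinObject (M : ℝ)
    (hno : ∀ q : ℝ, 0 < q → ∀ (v : ℝ → EuclideanSpace ℝ (Fin 3) → EuclideanSpace ℝ (Fin 3))
      (g : EuclideanSpace ℝ (Fin 3) → EuclideanSpace ℝ (Fin 3)), ¬ ThinObject M q v g) :
    ∃ F : ℝ → ℝ, (∀ ε : ℝ, 0 < ε → ∃ A₀ : ℝ, ∀ A : ℝ, A₀ ≤ A → F A ≤ Real.exp (ε * A ^ 3)) ∧
      ∀ (T τ A : ℝ) (u : ℝ → EuclideanSpace ℝ (Fin 3) → EuclideanSpace ℝ (Fin 3))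
        (p : ℝ → EuclideanSpace ℝ (Fin 3) → ℝ),
        (IsClassicalNSSolutionOn (Icc 0 T) 1 0 u p ∧ ∀ n : ℕ, ∃ C : NNReal, ∀ t ∈ Icc 0 T,
            eLpNorm (iteratedFDeriv ℝ n (u t)) 2 volume ≤ C) → 0 < τ →
        (∀ t ∈ Icc 0 T, ∀ x : EuclideanSpace ℝ (Fin 3), ‖u t x‖ ≤ M * (T + τ - t) ^ (-(1 / 2 : ℝ))) →
        (∀ t ∈ Icc 0 T, eLpNorm (u t) 3 volume ≤ ENNReal.ofReal A) → 2 ≤ A →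
        ∀ t ∈ Ioc 0 T, ∀ x : EuclideanSpace ℝ (Fin 3), ‖u t x‖ ≤ F A * t ^ (-(1 / 2 : ℝ)) := by
  refine quantSubcubicExpAt_of_forbiddenLengths M fun q hq => ?_
  by_contra h
  push Not at h
  obtain ⟨v, g, hvg⟩ := exists_thinObject_of_cheapCascades hq h
  exact hno q hq v g hvg

/-- **TRANSFER, Liouville form (qualitative ⇒ quantitative at a fixed constant).**  The rate-class
Type-I Liouville theorem at level `M` — every `v` with `IsTypeIAncientMild M v` vanishes on `t < 0` —
implies the crux's quantitative subcubic-exponential bound at level `M`: a universal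
`F = F_M` with `log F(A) = o(A³)` such that every Tao-frame solution on `[0,T]` with the virtual Type-I
bound `‖u(t,x)‖ ≤ M (T+τ−t)^{-1/2}` and `sup_t ‖u(t)‖₃ ≤ A`, `A ≥ 2`, obeys
`‖u(t,x)‖ ≤ F(A) t^{-1/2}` on `(0,T]`.  (Compactness: the rate is a supremum, not explicit.)
[folklore] -/
theorem quantSubcubicExpAt_of_rateLiouville (M : ℝ)
    (hL : ∀ v : ℝ → EuclideanSpace ℝ (Fin 3) → EuclideanSpace ℝ (Fin 3),
      IsTypeIAncientMild M v → ∀ t < 0, ∀ x, v t x = 0) :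
    ∃ F : ℝ → ℝ, (∀ ε : ℝ, 0 < ε → ∃ A₀ : ℝ, ∀ A : ℝ, A₀ ≤ A → F A ≤ Real.exp (ε * A ^ 3)) ∧
      ∀ (T τ A : ℝ) (u : ℝ → EuclideanSpace ℝ (Fin 3) → EuclideanSpace ℝ (Fin 3))
        (p : ℝ → EuclideanSpace ℝ (Fin 3) → ℝ),
        (IsClassicalNSSolutionOn (Icc 0 T) 1 0 u p ∧ ∀ n : ℕ, ∃ C : NNReal, ∀ t ∈ Icc 0 T,
            eLpNorm (iteratedFDeriv ℝ n (u t)) 2 volume ≤ C) → 0 < τ →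
        (∀ t ∈ Icc 0 T, ∀ x : EuclideanSpace ℝ (Fin 3), ‖u t x‖ ≤ M * (T + τ - t) ^ (-(1 / 2 : ℝ))) →
        (∀ t ∈ Icc 0 T, eLpNorm (u t) 3 volume ≤ ENNReal.ofReal A) → 2 ≤ A →
        ∀ t ∈ Ioc 0 T, ∀ x : EuclideanSpace ℝ (Fin 3), ‖u t x‖ ≤ F A * t ^ (-(1 / 2 : ℝ)) :=
  quantSubcubicExpAt_of_noThinObject M fun q _ v g => not_thinObject_of_rateLiouville hL q v g

/-- **PROVED RUNG (unconditional): the crux `TypeIQuantSubcubicExp` holds at every Type-I constant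
`M < 1`.**  For such `M` there is a universal `F = F_M` with `log F(A) = o(A³)` such that every
Tao-frame solution on `[0,T]` (`ν = 1`, zero force, all `H^k` slice norms bounded) with the virtual
Type-I bound `‖u(t,x)‖ ≤ M (T+τ−t)^{-1/2}`, `τ > 0`, and `sup_t ‖u(t)‖₃ ≤ A`, `A ≥ 2`, obeys
`‖u(t,x)‖ ≤ F(A) t^{-1/2}` on `(0,T]`.  The small-constant Liouville theorem
`SimilarityEnstrophy.typeI_ancient_eq_zero_of_rate_lt_one` fed through the transfer.  The open content
of the crux is `M ≥ 1`. [folklore] -/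
theorem quantSubcubicExpAt_of_lt_one {M : ℝ} (hM : M < 1) :
    ∃ F : ℝ → ℝ, (∀ ε : ℝ, 0 < ε → ∃ A₀ : ℝ, ∀ A : ℝ, A₀ ≤ A → F A ≤ Real.exp (ε * A ^ 3)) ∧
      ∀ (T τ A : ℝ) (u : ℝ → EuclideanSpace ℝ (Fin 3) → EuclideanSpace ℝ (Fin 3))
        (p : ℝ → EuclideanSpace ℝ (Fin 3) → ℝ),
        (IsClassicalNSSolutionOn (Icc 0 T) 1 0 u p ∧ ∀ n : ℕ, ∃ C : NNReal, ∀ t ∈ Icc 0 T,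
            eLpNorm (iteratedFDeriv ℝ n (u t)) 2 volume ≤ C) → 0 < τ →
        (∀ t ∈ Icc 0 T, ∀ x : EuclideanSpace ℝ (Fin 3), ‖u t x‖ ≤ M * (T + τ - t) ^ (-(1 / 2 : ℝ))) →
        (∀ t ∈ Icc 0 T, eLpNorm (u t) 3 volume ≤ ENNReal.ofReal A) → 2 ≤ A →
        ∀ t ∈ Ioc 0 T, ∀ x : EuclideanSpace ℝ (Fin 3), ‖u t x‖ ≤ F A * t ^ (-(1 / 2 : ℝ)) :=
  quantSubcubicExpAt_of_rateLiouville M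
    fun _ hv => SimilarityEnstrophy.typeI_ancient_eq_zero_of_rate_lt_one hv hM

end Summit.NavierStokesRegularity.NavierStokesRegularity.Theorems.ThinCascade

end
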